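import Summits.CriticalPhenomena.PercolationContinuityZ3.Theorems.PercNearOneGluingNoHeavyLowerTailDualBHKMaster
import Summits.CriticalPhenomena.PercolationContinuityZ3.Theorems.PercNearOneGluingNoHeavyLowerTailCubicThreePointApexRefined
import HarnessLib

/-!
# `NoHeavyLowerTail` (stmt-CriticalPhenomena-4575) — THEOREM: the dual BHK inequality `u₁·u₂ ≥ t·n′` on every finite weighted graph

Final file 8/8 of the dual BHK formalisation (prover prim-ineq-gen-2 gen 6, new-inequality factory;
`--supports stmt-CriticalPhenomena-4575`).  No named facts, no sorries.

WHAT.  For bond percolation on an arbitrary finite weighted graph (random edges `D` with weights `p ∈ [0,1]`, forced edges `K`)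
and terminals `a, b, c`, in the lane's cell vocabulary (`…CubicThreePointSections`, `…CubicThreePointApexRefined`):
`t = P(abc)`, `u₁ = P(ab|c)`, `u₂ = P(ac|b)` and the apex-refined cell `n′ = P(a|b|c ∧ V(C_a) separates b from c in the
support D ∪ K)` (`evNp`):

  `dualBHK`:   `PrW(evT) · PrW(evNp) ≤ PrW(evU₁) · PrW(evU₂)`,   i.e.   `t · n′ ≤ u₁ · u₂`.

Equivalently: conditionally on the event that the open cluster of `a` separates `b` from `c`, the events `{a ↔ b}` and
`{a ↔ c}` are NEGATIVELY correlated.  This is the census law `u_b u_c − t n′_a ≥ 0` of the ttrl `hms` programme (0 violations in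
41.3M exact instances; cp-cst: the families below have 0 violations in 20.5G + 0.64G exhaustive instances, n ≤ 7), the "dual" of
the BHK-type row `Γ₁ = AG − u₃ n′ ≥ 0` (`…CubicThreePointApexGammaOne`); together they make both brackets of the lane's `D₁`
nonnegative.  It is NOT a consequence of van den Berg–Häggström–Kahn (their Thm 1.3/1.5 template fails: the territory process is
not positively associated) and has no small switching certificate; the proof is a new Ahlswede–Daykin vertex-peeling induction
for two families of inequalities between events of GLUED clusters (files `…DualBHKDefs/Graph/Sep/Events/Base/Block/EA/Master`):
`MASTER(M,M′,𝔐;X,Y,N)`: `t(M,X)·q⁺(M′∪Y;𝔐,N) ≤ Ξ(M∪M′;X∩Y)·Ξ(X∪Y;M∩M′)` (`master_univ`), whose instance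
`MASTER({b},{b},{b};{c},{c},{c})` is the present theorem, and `EA` (`ea_univ`), which closes the base case through the
identity `t = α + β − θ`, `(α−θ)(β−θ) ≥ 0`.  Memo: run/shared/lean/prim/prim-ineq-gen-2/DUAL-BHK.md §8; spec EA-MASTER-SPEC.md.
[this work; pattern cited: VandenbergHaggstromKahn2005, Thm. 1.1]
-/

namespace Summit.CriticalPhenomena.PercolationContinuityZ3.Theorems

namespace DualBHK

open SimpleGraph Finset Literature.Probability.Percolation.DecisionTree

variable {V : Type*} [DecidableEq V]

omit [DecidableEq V] in
/-- Gluing at most one vertex does nothing. [this work] -/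
theorem gl_subsingleton {A : Set V} (h : A.Subsingleton) : gl A = ⊥ := by
  ext x y
  simp only [gl_adj, bot_adj, iff_false]
  rintro ⟨hne, hx, hy⟩
  exact hne (h hx hy)

omit [DecidableEq V] in
/-- If the universe contains all endpoints, the open graph inside `U` is the plain open graph. [this work] -/
theorem og_eq_fromEdgeSet {U : Finset V} {O : Finset (Sym2 V)} (hU : ∀ e ∈ O, ∀ z, z ∈ e → z ∈ U) :
    og U O = fromEdgeSet (↑O : Set (Sym2 V)) := by
  ext x y
  rw [og_adj, fromEdgeSet_adj, Finset.mem_coe]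
  constructor
  · rintro ⟨h, -, -, hne⟩
    exact ⟨h, hne⟩
  · rintro ⟨h, hne⟩
    exact ⟨h, hU _ h x (Sym2.mem_mk_left x y), hU _ h y (Sym2.mem_mk_right x y), hne⟩

omit [DecidableEq V] in
/-- … and so is the structure graph with trivial hubs. [this work] -/
theorem sG_eq_fromEdgeSet {U : Finset V} {O : Finset (Sym2 V)} (hU : ∀ e ∈ O, ∀ z, z ∈ e → z ∈ U) {A B : Set V}
    (hA : A.Subsingleton) (hB : B.Subsingleton) : sG U O A B = fromEdgeSet (↑O : Set (Sym2 V)) := by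
  simp only [sG, gl_subsingleton hA, gl_subsingleton hB, sup_bot_eq, og_eq_fromEdgeSet hU]

/-- **THEOREM (dual BHK inequality).**  On every finite weighted graph, `t · n′ ≤ u₁ · u₂`:
`P(abc) · P(a|b|c ∧ C_a separates b from c) ≤ P(ab|c) · P(ac|b)`. [this work] -/
theorem dualBHK {p : Sym2 V → ℝ} (hp0 : ∀ e, 0 ≤ p e) (hp1 : ∀ e, p e ≤ 1) (D K : Finset (Sym2 V)) (a b c : V) :
    PrW D p (CubicThreePointStep.evT K a b c) * PrW D p (CubicThreePointApex.evNp (D ∪ K) K a b c) ≤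
      PrW D p (CubicThreePointStep.evU₁ K a b c) * PrW D p (CubicThreePointStep.evU₂ K a b c) := by
  -- the universe: all endpoints of `D ∪ K` and the three terminals
  set U : Finset V := (D ∪ K).biUnion Sym2.toFinset ∪ {a, b, c} with hU
  have haU : a ∈ U := Finset.mem_union_right _ (by simp)
  have hbU : ({b} : Set V) ⊆ ↑U := by
    intro x hx
    rw [Set.mem_singleton_iff.1 hx, Finset.mem_coe]
    exact Finset.mem_union_right _ (by simp)
  have hcU : ({c} : Set V) ⊆ ↑U := by
    intro x hx
    rw [Set.mem_singleton_iff.1 hx, Finset.mem_coe]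
    exact Finset.mem_union_right _ (by simp)
  have hE : ∀ S, S ⊆ D → ∀ e ∈ S ∪ K, ∀ z, z ∈ e → z ∈ U := by
    intro S hS e he z hz
    refine Finset.mem_union_left _ (Finset.mem_biUnion.2 ⟨e, ?_, Sym2.mem_toFinset.2 hz⟩)
    exact Finset.union_subset_union hS le_rfl he
  have hb1 : ({b} : Set V).Subsingleton := Set.subsingleton_singleton
  have hc1 : ({c} : Set V).Subsingleton := Set.subsingleton_singleton
  have he1 : (∅ : Set V).Subsingleton := Set.subsingleton_empty
  -- reachability in the structure graphs with trivial hubs is the lane's `R K S`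
  have hG : ∀ S, S ⊆ D → ∀ (A B : Set V), A.Subsingleton → B.Subsingleton → ∀ x y,
      (sG U (S ∪ K) A B).Reachable x y ↔ CubicThreePointStep.R K S x y := by
    intro S hS A B hA hB x y
    rw [sG_eq_fromEdgeSet (hE S hS) hA hB]
    rfl
  -- Theorem 2 for `MASTER({b},{b},{b};{c},{c},{c})`
  have hM := master_univ (D := D) (F := K) (E := D ∪ K) (p := p) (a := a) hp0 hp1 Finset.subset_union_left
    Finset.subset_union_right U {b} {b} {b} {c} {c} {c} haU hbU hcU le_rfl le_rfl le_rfl le_rfl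
  rw [Set.union_self, Set.inter_self, Set.union_self, Set.inter_self] at hM
  -- identify the four factors on configurations `S ⊆ D`
  have e1 : PrW D p (CubicThreePointStep.evT K a b c) = PrW D p (evT U K a {b} {c}) := by
    refine le_antisymm (PrW_mono D hp0 hp1 fun S hS h => ?_) (PrW_mono D hp0 hp1 fun S hS h => ?_)
    · rw [CubicThreePointStep.mem_evT] at h
      exact ⟨⟨b, rfl, (hG S hS _ _ hb1 hc1 a b).2 h.1⟩, ⟨c, rfl, (hG S hS _ _ hb1 hc1 a c).2 h.2⟩⟩
    · obtain ⟨⟨m, hm, hrm⟩, ⟨x, hx, hrx⟩⟩ := h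
      rw [Set.mem_singleton_iff] at hm hx
      subst hm hx
      exact ⟨(hG S hS _ _ hb1 hc1 a _).1 hrm, (hG S hS _ _ hb1 hc1 a _).1 hrx⟩
  have e2 : PrW D p (CubicThreePointApex.evNp (D ∪ K) K a b c) ≤
      PrW D p (evQp U (D ∪ K) K a ({b} ∪ {c}) {b} {c}) := by
    refine PrW_mono D hp0 hp1 fun S hS h => ?_
    rw [CubicThreePointApex.mem_evNp] at h
    obtain ⟨⟨hab, hac, -⟩, hsep⟩ := h
    refine ⟨?_, ?_⟩
    · rintro z (hz | hz) <;> rw [Set.mem_singleton_iff] at hz <;> subst hz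
      · exact fun h' => hab ((hG S hS _ _ he1 he1 a _).1 h')
      · exact fun h' => hac ((hG S hS _ _ he1 he1 a _).1 h')
    · intro q hq r hr ⟨_, _, hreach⟩
      rw [Set.mem_singleton_iff] at hq hr
      subst hq hr
      apply hsep
      refine hreach.mono fun x y hxy => ?_
      rw [resG_adj, og_adj] at hxy
      obtain ⟨⟨hO, -, -, hne⟩, hxW, hyW⟩ := hxy
      rw [fromEdgeSet_adj]
      refine ⟨⟨hO, fun z hz => ?_⟩, hne⟩
      rcases Sym2.mem_iff.1 hz with rfl | rfl
      · exact fun h' => hxW ((hG S hS _ _ he1 he1 a _).2 h')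
      · exact fun h' => hyW ((hG S hS _ _ he1 he1 a _).2 h')
  have e3 : PrW D p (evXi U K a {b} {c}) = PrW D p (CubicThreePointStep.evU₁ K a b c) := by
    refine le_antisymm (PrW_mono D hp0 hp1 fun S hS h => ?_) (PrW_mono D hp0 hp1 fun S hS h => ?_)
    · obtain ⟨⟨m, hm, hrm⟩, hZ⟩ := h
      rw [Set.mem_singleton_iff] at hm
      subst hm
      rw [CubicThreePointStep.mem_evU₁]
      exact ⟨(hG S hS _ _ hb1 he1 a _).1 hrm, fun h' => hZ c rfl ((hG S hS _ _ hb1 he1 a c).2 h')⟩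
    · rw [CubicThreePointStep.mem_evU₁] at h
      refine ⟨⟨b, rfl, (hG S hS _ _ hb1 he1 a b).2 h.1⟩, fun z hz h' => ?_⟩
      rw [Set.mem_singleton_iff] at hz
      subst hz
      exact h.2 ((hG S hS _ _ hb1 he1 a _).1 h')
  have e4 : PrW D p (evXi U K a {c} {b}) = PrW D p (CubicThreePointStep.evU₂ K a b c) := by
    refine le_antisymm (PrW_mono D hp0 hp1 fun S hS h => ?_) (PrW_mono D hp0 hp1 fun S hS h => ?_)
    · obtain ⟨⟨m, hm, hrm⟩, hZ⟩ := h
      rw [Set.mem_singleton_iff] at hm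
      subst hm
      rw [CubicThreePointStep.mem_evU₂]
      exact ⟨(hG S hS _ _ hc1 he1 a _).1 hrm, fun h' => hZ b rfl ((hG S hS _ _ hc1 he1 a b).2 h')⟩
    · rw [CubicThreePointStep.mem_evU₂] at h
      refine ⟨⟨c, rfl, (hG S hS _ _ hc1 he1 a c).2 h.1⟩, fun z hz h' => ?_⟩
      rw [Set.mem_singleton_iff] at hz
      subst hz
      exact h.2 ((hG S hS _ _ hc1 he1 a _).1 h')
  calc PrW D p (CubicThreePointStep.evT K a b c) * PrW D p (CubicThreePointApex.evNp (D ∪ K) K a b c)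
      ≤ PrW D p (evT U K a {b} {c}) * PrW D p (evQp U (D ∪ K) K a ({b} ∪ {c}) {b} {c}) := by
        rw [e1]
        exact mul_le_mul_of_nonneg_left e2 (PrW_nonneg D hp0 hp1 _)
    _ ≤ PrW D p (evXi U K a {b} {c}) * PrW D p (evXi U K a {c} {b}) := hM
    _ = PrW D p (CubicThreePointStep.evU₁ K a b c) * PrW D p (CubicThreePointStep.evU₂ K a b c) := by
        rw [e3, e4]

/-- The dual BHK inequality in slack form: `0 ≤ u₁ u₂ − t n′`. [this work] -/
theorem dualBHK' {p : Sym2 V → ℝ} (hp0 : ∀ e, 0 ≤ p e) (hp1 : ∀ e, p e ≤ 1) (D K : Finset (Sym2 V)) (a b c : V) :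
    0 ≤ PrW D p (CubicThreePointStep.evU₁ K a b c) * PrW D p (CubicThreePointStep.evU₂ K a b c) -
      PrW D p (CubicThreePointStep.evT K a b c) * PrW D p (CubicThreePointApex.evNp (D ∪ K) K a b c) :=
  sub_nonneg.2 (dualBHK hp0 hp1 D K a b c)

end DualBHK

end Summit.CriticalPhenomena.PercolationContinuityZ3.Theorems
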